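import Literature.Computability.Complexity.Oracle
import Literature.Computability.Complexity.OracleProofs
import Literature.Computability.Complexity.CookReducibilityTransitive
import Literature.Computability.Complexity.PairProjections
import Literature.Computability.Complexity.ProbabilisticClasses
import HarnessLib

/-!
# `P^O ⊆ BPP^O` (proof; trunk CplxCore)

Sibling proof file of `Oracle.lean` (D-0014), discharging its named fact
`Literature.CplxCore.PRel_subset_BPPRel : ∀ O, PRel O ⊆ BPPRel O` (Bennett–Gill 1981, §1: `P^A ⊆ BPP^A`
for every oracle — ignore the coins), the relativised form of `P_subset_BPP_holds`
(`ProbabilisticClassesProofs.lean`, Gill 1977, Prop. 5.1). It is a decomposition node of the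
provefact plan for the algebrization barrier `Literature.Barriers.QuantumAdvantage.Algebrization`
(last step `P^A ⊆ BPP^A` of the Aaronson–Wigderson Thm. 5.2 collapse `BQP^Ã ⊆ P^A ⊆ BPP^A`).

Proof: for `L ∈ P^O` the witness language of `BPP^O = bp (P^O)` is
`L' = {w | (boolUnpair w).1 ∈ L}`; it is in `P^O` because `L' ≤ₚ L` by the first pairing
projection (`boolUnpairFst_mem_FP`, `PairProjections.lean`), Karp reductions are Cook reductions
(`PolyTimeKarpReducible.turing_holds`, `OracleProofs.lean`) and `P^O` is closed downwards under
Cook reductions (`mem_PRel_of_polyTimeTuringReducible_holds`, `CookReducibilityTransitive.lean`);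
then every coin string gives the correct verdict (`uniformProb_univ`). Kept out of
`OracleProofs.lean` because the Cook-closure theorem lives above it in the import order
(same arrangement as `OracleEmpty.lean` for `PRel_empty_holds`).

## References

* C. H. Bennett, J. Gill, *Relative to a random oracle `A`, `P^A ≠ NP^A ≠ co-NP^A` with
  probability 1*, SIAM J. Comput. 10 (1981) 96–113, §1 (relativised probabilistic classes,
  `P^A ⊆ BPP^A`).
* J. Gill, *Computational complexity of probabilistic Turing machines*, SIAM J. Comput. 6
  (1977), Prop. 5.1 (`P ⊆ BPP`).
-/

namespace Literature.Computability.Complexity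

open _root_.Computability
open scoped Notation

/-- `P^O` is closed under the first pairing projection: if `L ∈ P^O` then
`{w | (boolUnpair w).1 ∈ L} ∈ P^O` (Karp-reduce by `w ↦ (boolUnpair w).1 ∈ FP`, then use the
downward closure of `P^O` under Cook reductions). [cite: LadnerLynchSelman1975, §2] -/
theorem PRel_closed_boolUnpair_fst (O : Oracle) {L : Language Bool} (hL : L ∈ PRel O) :
    ({w | (boolUnpair w).1 ∈ L} : Language Bool) ∈ PRel O := by
  have hk : ({w | (boolUnpair w).1 ∈ L} : Language Bool) ≤ₚ L :=
    ⟨fun w => (boolUnpair w).1, boolUnpairFst_mem_FP, fun _ => Iff.rfl⟩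
  exact mem_PRel_of_polyTimeTuringReducible_holds (PolyTimeKarpReducible.turing_holds hk) hL

/-- **Discharge of `PRel_subset_BPPRel`** (`Oracle.lean`): `P^O ⊆ BPP^O` for every oracle `O` —
take the witness `L' = {w | (boolUnpair w).1 ∈ L} ∈ P^O` and zero coins; every coin string is
correct. [cite: BennettGill1981, §1] -/
theorem PRel_subset_BPPRel_holds : PRel_subset_BPPRel := by
  intro O L hL
  set L' : Language Bool := {w | (boolUnpair w).1 ∈ L} with hL'
  refine ⟨L', PRel_closed_boolUnpair_fst O hL, 0, fun x => ?_⟩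
  have hset : {y : List Bool | boolPair x y ∈ L' ↔ x ∈ L} = Set.univ := by
    refine Set.eq_univ_of_forall fun y => ?_
    change (boolUnpair (boolPair x y)).1 ∈ L ↔ x ∈ L
    rw [boolUnpair_boolPair]
  rw [hset, uniformProb_univ]
  norm_num

end Literature.Computability.Complexity
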